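import Mathlib

/-!
# Crux `WordLengthQP` (stmt-ValiantsHypothesis-6623), line `Sketch` (eps-order-ladder) —
stub `stub_indgLetters`

Allender–Wang 2016 (ECCC TR11-083), Lemma 36, in matrix form ("inherently non-degenerate matrices
are products of letters"): a width-2 matrix over `ℂ[x̄]` with S-affine entries (each entry `C b`
or `C a * X v + C b`) whose determinant is a non-zero constant is a product of LETTERS — elementary
matrices `E(ℓ) = !![1, ℓ; 0, 1]` with `ℓ.totalDegree ≤ 1`, the swap `w = !![0, 1; 1, 0]`, and
invertible constant diagonal matrices `!![C d₁, 0; 0, C d₂]`.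

Proof: write `m = M₀.map C * (1 + N)` with `M₀` the (invertible) constant part and `N` a matrix of
linear forms; `det (1 + N) = 1` forces `tr N = det N = 0`, and unique factorisation in `ℂ[x̄]`
(a non-zero linear form is prime) gives `N = P • !![1, α; -α⁻¹, -1]` or `N` nilpotent triangular;
each case is an explicit product of letters (Bruhat decomposition for the constant factors).
-/

-- `Summit.ValiantsHypothesis.ValiantsHypothesis.…` is the tree's mandated single-conjunct layout
-- (Sub = Summit), so the duplicated namespace component is intended.
set_option linter.dupNamespace false

noncomputable section

open MvPolynomial

namespace Summit.ValiantsHypothesis.ValiantsHypothesis.Cruxes.WordLengthQP.EpsOrderLadder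

/-! ### Generic bookkeeping for "products of letters" -/

/-- Products of `L`-words are closed under multiplication. [folklore] -/
theorem indgLetters_prod_mul {M : Type*} [Monoid M] (L : M → Prop) {a b : M}
    (ha : ∃ ws : List M, (∀ x ∈ ws, L x) ∧ ws.prod = a)
    (hb : ∃ ws : List M, (∀ x ∈ ws, L x) ∧ ws.prod = b) :
    ∃ ws : List M, (∀ x ∈ ws, L x) ∧ ws.prod = a * b := by
  obtain ⟨u, hu, rfl⟩ := ha
  obtain ⟨v, hv, rfl⟩ := hb
  exact ⟨u ++ v, List.forall_mem_append.2 ⟨hu, hv⟩, List.prod_append⟩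

/-- A single letter is an `L`-word. [folklore] -/
theorem indgLetters_prod_single {M : Type*} [Monoid M] (L : M → Prop) {a : M} (ha : L a) :
    ∃ ws : List M, (∀ x ∈ ws, L x) ∧ ws.prod = a :=
  ⟨[a], by simpa using ha, List.prod_singleton⟩

/-- Entrywise map of an explicit `2 × 2` matrix. [folklore] -/
theorem indgLetters_map_two {R S : Type*} (f : R → S) (a b c d : R) :
    (!![a, b; c, d] : Matrix (Fin 2) (Fin 2) R).map f = !![f a, f b; f c, f d] := by
  ext i j : 1
  fin_cases i <;> fin_cases j <;> rfl

/-! ### Constant invertible matrices are products of letters (Bruhat decomposition) -/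

/-- An invertible constant `2 × 2` matrix (pushed into `ℂ[x̄]`) is a product of letters:
`!![p, q; 0, s] = D(p, s) * E(q / p)` and, for `r ≠ 0`,
`!![p, q; r, s] = E(p / r) * w * D(r, (q r - p s) / r) * E(s / r)`. [folklore] -/
theorem indgLetters_const {σ : Type} (p q r s : ℂ) (h : p * s - q * r ≠ 0) :
    ∃ ws : List (Matrix (Fin 2) (Fin 2) (MvPolynomial σ ℂ)),
      (∀ x ∈ ws, (∃ ℓ : MvPolynomial σ ℂ, ℓ.totalDegree ≤ 1 ∧ x = !![1, ℓ; 0, 1]) ∨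
        x = !![0, 1; 1, 0] ∨
        (∃ d₁ d₂ : ℂ, d₁ ≠ 0 ∧ d₂ ≠ 0 ∧
          x = !![MvPolynomial.C d₁, 0; 0, MvPolynomial.C d₂])) ∧
      ws.prod = !![C p, C q; C r, C s] := by
  rcases eq_or_ne r 0 with hr | hr
  · -- upper triangular: `D(p, s) * E(q / p)`
    have hp : p ≠ 0 := by
      rintro rfl
      apply h
      rw [hr, zero_mul, mul_zero, sub_zero]
    have hs : s ≠ 0 := by
      rintro rfl
      apply h
      rw [hr, mul_zero, mul_zero, sub_zero]
    have hinv : p * p⁻¹ = 1 := mul_inv_cancel₀ hp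
    have hG : (!![p, q; r, s] : Matrix (Fin 2) (Fin 2) ℂ) =
        !![p, 0; 0, s] * !![1, q / p; 0, 1] := by
      rw [hr]
      simp only [Matrix.mul_fin_two]
      congr 1
      refine Matrix.vec2_eq (Matrix.vec2_eq ?_ ?_) (Matrix.vec2_eq ?_ ?_)
      · ring
      · linear_combination (-q) * hinv
      · ring
      · ring
    have hG' := congrArg (fun G : Matrix (Fin 2) (Fin 2) ℂ => G.map (C : ℂ →+* MvPolynomial σ ℂ)) hG
    simp only [Matrix.map_mul, indgLetters_map_two, map_zero, map_one] at hG'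
    rw [hG']
    exact indgLetters_prod_mul _
      (indgLetters_prod_single _ (Or.inr (Or.inr ⟨p, s, hp, hs, rfl⟩)))
      (indgLetters_prod_single _
        (Or.inl ⟨C (q / p), (totalDegree_C _).trans_le (Nat.zero_le _), rfl⟩))
  · -- `r ≠ 0`: `E(p / r) * w * D(r, t) * E(s / r)`
    have ht : (q * r - p * s) / r ≠ 0 := by
      refine div_ne_zero ?_ hr
      intro h0
      apply h
      linear_combination -h0
    have hinv : r * r⁻¹ = 1 := mul_inv_cancel₀ hr
    have hG : (!![p, q; r, s] : Matrix (Fin 2) (Fin 2) ℂ) =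
        !![1, p / r; 0, 1] * !![0, 1; 1, 0] * !![r, 0; 0, (q * r - p * s) / r] *
          !![1, s / r; 0, 1] := by
      simp only [Matrix.mul_fin_two]
      congr 1
      refine Matrix.vec2_eq (Matrix.vec2_eq ?_ ?_) (Matrix.vec2_eq ?_ ?_)
      · linear_combination (-p) * hinv
      · linear_combination (-(q + p * s / r)) * hinv
      · ring
      · linear_combination (-s) * hinv
    have hG' := congrArg (fun G : Matrix (Fin 2) (Fin 2) ℂ => G.map (C : ℂ →+* MvPolynomial σ ℂ)) hG
    simp only [Matrix.map_mul, indgLetters_map_two, map_zero, map_one] at hG'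
    rw [hG']
    refine indgLetters_prod_mul _ (indgLetters_prod_mul _ (indgLetters_prod_mul _
      (indgLetters_prod_single _
        (Or.inl ⟨C (p / r), (totalDegree_C _).trans_le (Nat.zero_le _), rfl⟩))
      (indgLetters_prod_single _ (Or.inr (Or.inl rfl))))
      (indgLetters_prod_single _ (Or.inr (Or.inr ⟨r, _, hr, ht, rfl⟩))))
      (indgLetters_prod_single _
        (Or.inl ⟨C (s / r), (totalDegree_C _).trans_le (Nat.zero_le _), rfl⟩))

/-- Matrix form of `indgLetters_const`: for `G : Matrix (Fin 2) (Fin 2) ℂ` with `G.det ≠ 0`,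
`G.map C` is a product of letters. [folklore] -/
theorem indgLetters_constMap {σ : Type} (G : Matrix (Fin 2) (Fin 2) ℂ) (hG : G.det ≠ 0) :
    ∃ ws : List (Matrix (Fin 2) (Fin 2) (MvPolynomial σ ℂ)),
      (∀ x ∈ ws, (∃ ℓ : MvPolynomial σ ℂ, ℓ.totalDegree ≤ 1 ∧ x = !![1, ℓ; 0, 1]) ∨
        x = !![0, 1; 1, 0] ∨
        (∃ d₁ d₂ : ℂ, d₁ ≠ 0 ∧ d₂ ≠ 0 ∧
          x = !![MvPolynomial.C d₁, 0; 0, MvPolynomial.C d₂])) ∧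
      ws.prod = G.map MvPolynomial.C := by
  have e : G.map (C : ℂ →+* MvPolynomial σ ℂ) =
      !![C (G 0 0), C (G 0 1); C (G 1 0), C (G 1 1)] := by
    ext i j : 1
    fin_cases i <;> fin_cases j <;> rfl
  rw [e]
  refine indgLetters_const _ _ _ _ ?_
  rwa [Matrix.det_fin_two] at hG

/-! ### Linear forms: primality and the rank-one structure of `N` -/

/-- A non-zero linear form over `ℂ` is prime in `ℂ[x̄]` (UFD + `irreducible_of_totalDegree_eq_one`).
[folklore] -/
theorem indgLetters_prime {σ : Type} {P : MvPolynomial σ ℂ} (hP : P.IsHomogeneous 1)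
    (hP0 : P ≠ 0) : Prime P := by
  refine UniqueFactorizationMonoid.irreducible_iff_prime.mp
    (irreducible_of_totalDegree_eq_one (hP.totalDegree hP0) fun x hx => ?_)
  obtain ⟨i, hi⟩ := exists_coeff_ne_zero hP0
  refine isUnit_iff_ne_zero.mpr ?_
  rintro rfl
  exact hi (zero_dvd_iff.mp (hx i))

/-- If a non-zero linear form `P` divides a non-zero linear form `Q`, then `Q = C α * P` with
`α ≠ 0`. [folklore] -/
theorem indgLetters_dvd_lin {σ : Type} {P Q : MvPolynomial σ ℂ} (hP : P.IsHomogeneous 1)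
    (hQ : Q.IsHomogeneous 1) (hP0 : P ≠ 0) (hQ0 : Q ≠ 0) (h : P ∣ Q) :
    ∃ α : ℂ, α ≠ 0 ∧ Q = C α * P := by
  obtain ⟨u, rfl⟩ := h
  have hu0 : u ≠ 0 := by
    rintro rfl
    exact hQ0 (mul_zero P)
  have hdeg := totalDegree_mul_of_isDomain hP0 hu0
  rw [hQ.totalDegree hQ0, hP.totalDegree hP0] at hdeg
  have hu : u.totalDegree = 0 := by omega
  rw [totalDegree_eq_zero_iff_eq_C] at hu
  refine ⟨u.coeff 0, ?_, ?_⟩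
  · intro h0
    apply hu0
    rw [hu, h0, C_0]
  · calc P * u = u * P := mul_comm _ _
      _ = C (u.coeff 0) * P := by rw [← hu]

/-- Rank-one structure: if `P ≠ 0`, `Q`, `S` are linear forms with `Q * S = -(P * P)`, then
`Q = C α * P` and `S = C (-α⁻¹) * P` for some `α ≠ 0`. [folklore] -/
theorem indgLetters_rank_one {σ : Type} {P Q S : MvPolynomial σ ℂ} (hP : P.IsHomogeneous 1)
    (hQ : Q.IsHomogeneous 1) (hS : S.IsHomogeneous 1) (hP0 : P ≠ 0)
    (hQS : Q * S = -(P * P)) :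
    ∃ α : ℂ, α ≠ 0 ∧ Q = C α * P ∧ S = C (-α⁻¹) * P := by
  have hPP : P * P ≠ 0 := mul_ne_zero hP0 hP0
  have hQ0 : Q ≠ 0 := by
    rintro rfl
    apply hPP
    linear_combination hQS
  have hS0 : S ≠ 0 := by
    rintro rfl
    apply hPP
    linear_combination hQS
  have hdvd : P ∣ Q * S := by
    rw [hQS]
    exact (dvd_mul_right P P).neg_right
  rcases (indgLetters_prime hP hP0).dvd_or_dvd hdvd with h | h
  · obtain ⟨α, hα, hQα⟩ := indgLetters_dvd_lin hP hQ hP0 hQ0 h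
    refine ⟨α, hα, hQα, ?_⟩
    have h1 : P * (C α * S + P) = 0 := by
      rw [hQα] at hQS
      linear_combination hQS
    have h2 : C α * S + P = 0 := (mul_eq_zero.mp h1).resolve_left hP0
    have key : C α⁻¹ * C α = (1 : MvPolynomial σ ℂ) := by
      rw [← C_mul, inv_mul_cancel₀ hα, C_1]
    rw [C_neg]
    linear_combination (C α⁻¹) * h2 + (-S) * key
  · obtain ⟨β, hβ, hSβ⟩ := indgLetters_dvd_lin hP hS hP0 hS0 h
    refine ⟨-β⁻¹, by simp [hβ], ?_, ?_⟩
    · have h1 : P * (C β * Q + P) = 0 := by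
        rw [hSβ] at hQS
        linear_combination hQS
      have h2 : C β * Q + P = 0 := (mul_eq_zero.mp h1).resolve_left hP0
      have key : C β⁻¹ * C β = (1 : MvPolynomial σ ℂ) := by
        rw [← C_mul, inv_mul_cancel₀ hβ, C_1]
      rw [C_neg]
      linear_combination (C β⁻¹) * h2 + (-Q) * key
    · rw [show -(-β⁻¹)⁻¹ = β by simp]
      exact hSβ

/-- The conjugation identity `1 + P • !![1, α; -α⁻¹, -1] = g * E(P) * g'` with the explicit
constant matrices `g = !![α, 0; -1, 1]`, `g' = !![α⁻¹, 0; α⁻¹, 1]`. [folklore] -/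
theorem indgLetters_conj {σ : Type} (P : MvPolynomial σ ℂ) (α : ℂ) (hα : α ≠ 0) :
    (!![1 + P, C α * P; C (-α⁻¹) * P, 1 + -P] : Matrix (Fin 2) (Fin 2) (MvPolynomial σ ℂ)) =
      (!![α, 0; -1, 1] : Matrix (Fin 2) (Fin 2) ℂ).map C * !![1, P; 0, 1] *
        (!![α⁻¹, 0; α⁻¹, 1] : Matrix (Fin 2) (Fin 2) ℂ).map C := by
  have key : C α * C α⁻¹ = (1 : MvPolynomial σ ℂ) := by
    rw [← C_mul, mul_inv_cancel₀ hα, C_1]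
  rw [indgLetters_map_two, indgLetters_map_two]
  simp only [Matrix.mul_fin_two, map_one, map_zero, map_neg]
  congr 1
  refine Matrix.vec2_eq (Matrix.vec2_eq ?_ ?_) (Matrix.vec2_eq ?_ ?_)
  · linear_combination (-(1 + P)) * key
  · ring
  · ring
  · ring

/-! ### The unipotent factor `1 + N` -/

/-- If `P, Q, S, T` are linear forms and `det !![1 + P, Q; S, 1 + T] = 1`, then
`!![1 + P, Q; S, 1 + T]` is a product of letters (AW16 Lemma 36, core case). [folklore] -/
theorem indgLetters_onePlus {σ : Type} (P Q S T : MvPolynomial σ ℂ) (hP : P.IsHomogeneous 1)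
    (hQ : Q.IsHomogeneous 1) (hS : S.IsHomogeneous 1) (hT : T.IsHomogeneous 1)
    (hdet : (!![1 + P, Q; S, 1 + T] : Matrix (Fin 2) (Fin 2) (MvPolynomial σ ℂ)).det = 1) :
    ∃ ws : List (Matrix (Fin 2) (Fin 2) (MvPolynomial σ ℂ)),
      (∀ x ∈ ws, (∃ ℓ : MvPolynomial σ ℂ, ℓ.totalDegree ≤ 1 ∧ x = !![1, ℓ; 0, 1]) ∨
        x = !![0, 1; 1, 0] ∨
        (∃ d₁ d₂ : ℂ, d₁ ≠ 0 ∧ d₂ ≠ 0 ∧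
          x = !![MvPolynomial.C d₁, 0; 0, MvPolynomial.C d₂])) ∧
      ws.prod = !![1 + P, Q; S, 1 + T] := by
  -- trace and determinant of `N = !![P, Q; S, T]` vanish, by homogeneity
  rw [Matrix.det_fin_two_of] at hdet
  have hsum : (P + T) + (P * T - Q * S) = 0 := by linear_combination hdet
  have hTr : P + T = 0 := by
    have h := congrArg (homogeneousComponent 1) hsum
    rw [map_add, map_zero, homogeneousComponent_of_mem (hP.add hT),
      homogeneousComponent_of_mem ((hP.mul hT).sub (hQ.mul hS))] at h
    simpa using h
  have hT' : T = -P := by linear_combination hTr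
  subst hT'
  have hQS : Q * S = -(P * P) := by linear_combination -hsum
  rcases eq_or_ne P 0 with hP0 | hP0
  · -- `P = 0`: `N` is nilpotent triangular
    rcases mul_eq_zero.mp (show Q * S = 0 by rw [hQS, hP0, mul_zero, neg_zero]) with hQ0 | hS0
    · -- `N = !![0, 0; S, 0]`, `1 + N = w * E(S) * w`
      have e : (!![1 + P, Q; S, 1 + -P] : Matrix (Fin 2) (Fin 2) (MvPolynomial σ ℂ)) =
          !![0, 1; 1, 0] * !![1, S; 0, 1] * !![0, 1; 1, 0] := by
        rw [hP0, hQ0]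
        simp only [Matrix.mul_fin_two]
        congr 1
        refine Matrix.vec2_eq (Matrix.vec2_eq ?_ ?_) (Matrix.vec2_eq ?_ ?_) <;> ring
      rw [e]
      exact indgLetters_prod_mul _ (indgLetters_prod_mul _
        (indgLetters_prod_single _ (Or.inr (Or.inl rfl)))
        (indgLetters_prod_single _ (Or.inl ⟨S, hS.totalDegree_le, rfl⟩)))
        (indgLetters_prod_single _ (Or.inr (Or.inl rfl)))
    · -- `N = !![0, Q; 0, 0]`, `1 + N = E(Q)`
      have e : (!![1 + P, Q; S, 1 + -P] : Matrix (Fin 2) (Fin 2) (MvPolynomial σ ℂ)) =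
          !![1, Q; 0, 1] := by
        rw [hP0, hS0, neg_zero, add_zero]
      rw [e]
      exact indgLetters_prod_single _ (Or.inl ⟨Q, hQ.totalDegree_le, rfl⟩)
  · -- `P ≠ 0`: rank-one structure and conjugation of `E(P)` by constant matrices
    obtain ⟨α, hα, hQα, hSα⟩ := indgLetters_rank_one hP hQ hS hP0 hQS
    rw [hQα, hSα, indgLetters_conj P α hα]
    refine indgLetters_prod_mul _ (indgLetters_prod_mul _ (indgLetters_constMap _ ?_)
      (indgLetters_prod_single _ (Or.inl ⟨P, hP.totalDegree_le, rfl⟩)))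
      (indgLetters_constMap _ ?_)
    · rw [Matrix.det_fin_two_of]
      simpa using hα
    · rw [Matrix.det_fin_two_of]
      simpa using hα

/-- Matrix form: if every entry of `N` is a linear form and `det (1 + N) = 1`, then `1 + N` is a
product of letters. [folklore] -/
theorem indgLetters_onePlusMat {σ : Type} (N : Matrix (Fin 2) (Fin 2) (MvPolynomial σ ℂ))
    (hN : ∀ i j, (N i j).IsHomogeneous 1) (hdet : (1 + N).det = 1) :
    ∃ ws : List (Matrix (Fin 2) (Fin 2) (MvPolynomial σ ℂ)),
      (∀ x ∈ ws, (∃ ℓ : MvPolynomial σ ℂ, ℓ.totalDegree ≤ 1 ∧ x = !![1, ℓ; 0, 1]) ∨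
        x = !![0, 1; 1, 0] ∨
        (∃ d₁ d₂ : ℂ, d₁ ≠ 0 ∧ d₂ ≠ 0 ∧
          x = !![MvPolynomial.C d₁, 0; 0, MvPolynomial.C d₂])) ∧
      ws.prod = 1 + N := by
  have e : 1 + N = !![1 + N 0 0, N 0 1; N 1 0, 1 + N 1 1] := by
    ext i j : 1
    fin_cases i <;> fin_cases j <;> simp
  rw [e] at hdet ⊢
  exact indgLetters_onePlus _ _ _ _ (hN 0 0) (hN 0 1) (hN 1 0) (hN 1 1) hdet

/-- The factorisation `m = M₀.map C * (1 + M₀⁻¹.map C * (m - M₀.map C))` for an invertible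
constant matrix `M₀`. [folklore] -/
theorem indgLetters_factor {σ : Type} (m : Matrix (Fin 2) (Fin 2) (MvPolynomial σ ℂ))
    (M₀ : Matrix (Fin 2) (Fin 2) ℂ) (hM₀ : IsUnit M₀.det) :
    m = M₀.map C * (1 + M₀⁻¹.map C * (m - M₀.map C)) := by
  rw [mul_add, mul_one, ← mul_assoc, ← Matrix.map_mul, Matrix.mul_nonsing_inv _ hM₀,
    Matrix.map_one _ C_0 C_1, one_mul, add_sub_cancel]

/-! ### The stub -/

/-- **stub_indgLetters** (Allender–Wang 2016, Lemma 36, S-model): a width-2 matrix with S-affine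
entries over `ℂ[x̄]` whose determinant is a non-zero constant is a product of letters
`E(ℓ) = !![1, ℓ; 0, 1]` (`ℓ` of total degree `≤ 1`), `w = !![0, 1; 1, 0]` and invertible constant
diagonal matrices. -/
theorem stub_indgLetters {σ : Type} [Fintype σ] [DecidableEq σ]
    (m : Matrix (Fin 2) (Fin 2) (MvPolynomial σ ℂ))
    (hS : ∀ i j : Fin 2, (∃ b : ℂ, m i j = MvPolynomial.C b) ∨
      (∃ (a b : ℂ) (v : σ), m i j = MvPolynomial.C a * MvPolynomial.X v + MvPolynomial.C b))
    (hdet : ∃ d : ℂ, d ≠ 0 ∧ m.det = MvPolynomial.C d) :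
    ∃ ws : List (Matrix (Fin 2) (Fin 2) (MvPolynomial σ ℂ)),
      (∀ x ∈ ws, (∃ ℓ : MvPolynomial σ ℂ, ℓ.totalDegree ≤ 1 ∧ x = !![1, ℓ; 0, 1]) ∨
        x = !![0, 1; 1, 0] ∨
        (∃ d₁ d₂ : ℂ, d₁ ≠ 0 ∧ d₂ ≠ 0 ∧
          x = !![MvPolynomial.C d₁, 0; 0, MvPolynomial.C d₂])) ∧
      ws.prod = m := by
  obtain ⟨d, hd0, hdet⟩ := hdet
  -- the linear part of every entry is homogeneous of degree `1`
  have hlin : ∀ i j, (m i j - C (constantCoeff (m i j))).IsHomogeneous 1 := by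
    intro i j
    rcases hS i j with ⟨b, hb⟩ | ⟨a, b, v, hb⟩
    · rw [hb, constantCoeff_C, sub_self]
      exact isHomogeneous_zero σ ℂ 1
    · rw [hb, map_add, map_mul, constantCoeff_C, constantCoeff_C, constantCoeff_X, mul_zero,
        zero_add, add_sub_cancel_right]
      exact isHomogeneous_C_mul_X a v
  -- the constant part `M₀ = m.map constantCoeff` has determinant `d ≠ 0`
  have hdet0 : (m.map constantCoeff).det = d := by
    rw [← RingHom.mapMatrix_apply, ← RingHom.map_det, hdet, constantCoeff_C]
  have hunit : IsUnit (m.map constantCoeff).det := by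
    rw [hdet0]
    exact isUnit_iff_ne_zero.mpr hd0
  -- `m = M₀.map C * (1 + N)` with `N` a matrix of linear forms
  obtain ⟨N, hN, hmN⟩ : ∃ N : Matrix (Fin 2) (Fin 2) (MvPolynomial σ ℂ),
      N = (m.map constantCoeff)⁻¹.map C * (m - (m.map constantCoeff).map C) ∧
        m = (m.map constantCoeff).map C * (1 + N) :=
    ⟨_, rfl, indgLetters_factor m _ hunit⟩
  have hNhom : ∀ i j, (N i j).IsHomogeneous 1 := by
    intro i j
    rw [hN, Matrix.mul_apply]
    refine IsHomogeneous.sum _ _ _ fun k _ => ?_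
    rw [Matrix.map_apply, Matrix.sub_apply, Matrix.map_apply, Matrix.map_apply]
    exact (hlin k j).C_mul _
  -- `det (1 + N) = 1`
  have hdet1 : (1 + N).det = 1 := by
    have h := congrArg Matrix.det hmN
    rw [Matrix.det_mul, hdet, ← RingHom.mapMatrix_apply, ← RingHom.map_det, hdet0] at h
    exact (mul_left_cancel₀ (C_ne_zero.mpr hd0) (h.symm.trans (mul_one _).symm))
  -- assemble
  obtain ⟨ws₁, hws₁, hprod₁⟩ :=
    indgLetters_constMap (σ := σ) (m.map constantCoeff) (by rw [hdet0]; exact hd0)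
  obtain ⟨ws₂, hws₂, hprod₂⟩ := indgLetters_onePlusMat N hNhom hdet1
  refine ⟨ws₁ ++ ws₂, List.forall_mem_append.2 ⟨hws₁, hws₂⟩, ?_⟩
  rw [List.prod_append, hprod₁, hprod₂, ← hmN]

end Summit.ValiantsHypothesis.ValiantsHypothesis.Cruxes.WordLengthQP.EpsOrderLadder
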